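import Summits.ResolutionOfSingularities.ResolutionOfSingularities.Theorems.FrobeniusClosingPatchingRelPerfectDepthTargetsWeightedDefs
import Summits.ResolutionOfSingularities.ResolutionOfSingularities.Theorems.FrobeniusClosingPatchingRelPerfectDepthOneRegularizeSupportEnd
import Literature.AlgebraicGeometry.Resolution.MonomialOrderReduction
import HarnessLib

/-!
# Crux `PatchingRelPerfect` (stmt-ResolutionOfSingularities-16161), chain w52 — rung R4, E-side:
# TARGET (a) of TargetsF2 BY NAME — the weight-`μ` CLEANUP of an snc-supported divisor (`WeightedCleanupSNC μ`)

[OURS · L1 W5.2 · rung tool] res-L1-w52-plan-1 g6, `ChainW52TargetsF2.lean` sha16 `79dee2c27fd85ddd` l.157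
(tree: `…Theorems.FrobeniusClosingPatchingRelPerfectDepthTargetsWeightedDefs`, p502025), STEER 05:26:19Z (a).
Fact-free; any dimension; nothing here is a statement of the manuscript under review.

On an integral Noetherian regular scheme `E`, a non-zero locally principal ideal sheaf `𝔟` whose support lies in a
strict normal crossings divisor `B` is brought BELOW ORDER `μ` everywhere (`1 ≤ μ`) by a PURE weight-`μ` sequence
of blowings up along regular centres (`DepthTargets.IsPureWeightedSeq μ`). Three steps, all on tree results:

* `DepthCleanup.exists_monomial_presentation` — `𝔟 = ∏_ζ 𝓘(cl{ζ})^{ord_ζ 𝔟}` over the codimension-one points of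
  `V(𝔟)` (Cossart–Piltant 2008, proof of Prop. 4.2: the divisorial part of a locally principal ideal is the ideal
  itself — `DivisorialPart.lean`), and these `ζ` are maximal points of `B`
  (`DepthOne.mem_maxPoints_of_coheight_eq_one`, p496404), whose component ideals form a simple-normal-crossings
  list (Stacks 0BIA (2) ⇒ (1), `IsStrictNormalCrossingsDivisor.exists_hasSNC`): `𝔟 = monomialIdeal L` with
  `HasSNC (boundaryOf L)`;
* the tree's ORDER REDUCTION FOR MARKED MONOMIAL IDEALS `exists_isResolutionOf_monomialMarked`
  (`MonomialOrderReduction.lean`: Kollár 2007 (3.111) Step 3 / BGMW 2011 §4 Step 2b — blow up strata of maximal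
  weight `≥ μ` until `supp(𝓘', μ) = ∅`);
* `DepthCleanup.pureWeightedSeq_of_isAdmissibleFor` — an admissible `CentreSeq` for a marked ideal `(X, 𝓘, E, μ)`
  IS a pure weight-`μ` sequence: every centre is regular with `𝓘_j ≤ C_j^μ` (BGMW Lemma 3.2.1 (1),
  `MarkedIdeal.ideal_le_pow`) and the transform is the weight-`μ` controlled transform
  (`MarkedIdeal.pow_mul_transform_ideal`); `supp = ∅` at the end reads `ord_x 𝓘' < μ` for all `x`
  (`DepthCleanup.idealOrder_lt_of_isResolutionOf`).

Main: `DepthTargets.weightedCleanupSNC_holds : ∀ μ, DepthTargets.WeightedCleanupSNC μ`.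

## References

* J. Kollár, *Lectures on Resolution of Singularities* (2007), (3.111) Step 3. [Kollar2007]
* E. Bierstone, D. Grigoriev, P. Milman, J. Włodarczyk, *Effective Hironaka resolution and its complexity*,
  Asian J. Math. 15 (2011), Def. 3.1.2, Def. 3.1.3, Lemma 3.2.1, §4 Step 2b. [BierstoneGrigorievMilmanWlodarczyk2011]
* V. Cossart, O. Piltant, J. Algebra 320 (2008), proof of Prop. 4.2. [CossartPiltant2008]
* The Stacks Project, Tag 0BIA. [StacksProject]
-/

-- `Summit.<Summit>.<Sub>.Theorems` with `Sub = Summit` (single-conjunct summit, D-0017)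
set_option linter.dupNamespace false

noncomputable section

open CategoryTheory CategoryTheory.Limits AlgebraicGeometry TopologicalSpace
open Literature.AlgebraicGeometry.Resolution

namespace Summit.ResolutionOfSingularities.ResolutionOfSingularities.Theorems

universe u

open Scheme.IdealSheafData (vanishingIdeal)

namespace DepthCleanup

open DepthTargets

/-! ### Pure weighted sequences: concatenation and the translation of the tree's `CentreSeq` resolutions -/

/-- **Concatenation of pure weight-`μ` sequences** (a pure weight-`μ` sequence on `E'` starting from the end
ideal of a pure weight-`μ` sequence `E' → E` extends it). [folklore] -/
theorem pureWeightedSeq_append {μ : ℕ} {E'' E' E : Scheme.{u}} {ρ : E' ⟶ E} {ρ' : E'' ⟶ E'}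
    {𝔟 : E.IdealSheafData} {𝔟' : E'.IdealSheafData} {𝔟'' : E''.IdealSheafData}
    (h' : IsPureWeightedSeq μ ρ' 𝔟' 𝔟'') :
    IsPureWeightedSeq μ ρ 𝔟 𝔟' → IsPureWeightedSeq μ (ρ' ≫ ρ) 𝔟 𝔟'' := by
  induction h' with
  | nil 𝔟₀ =>
      intro h
      simpa only [Category.id_comp] using h
  | cons τ ρ₀ 𝔟₀ 𝔟₁ 𝔟₂ C hseq hC hle hτ hctrl ih =>
      intro h
      rw [Category.assoc]
      exact IsPureWeightedSeq.cons τ (ρ₀ ≫ ρ) 𝔟 𝔟₁ 𝔟₂ C (ih h) hC hle hτ hctrl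

/-- A single weight-`μ` permissible blowing up is a pure weight-`μ` sequence of length one. [folklore] -/
theorem pureWeightedSeq_single {μ : ℕ} {E' E : Scheme.{u}} (τ : E' ⟶ E) (𝔟 : E.IdealSheafData)
    (𝔟' : E'.IdealSheafData) (C : E.IdealSheafData) (hC : Scheme.IsRegular C.subscheme)
    (hle : 𝔟 ≤ C ^ μ) (hτ : IsBlowup τ C) (hctrl : 𝔟.comap τ = C.comap τ ^ μ * 𝔟') :
    IsPureWeightedSeq μ τ 𝔟 𝔟' := by
  have h := IsPureWeightedSeq.cons τ (𝟙 E) 𝔟 𝔟 𝔟' C (IsPureWeightedSeq.nil 𝔟) hC hle hτ hctrl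
  simpa only [Category.comp_id] using h

/-- **The tree's multiple blow-ups of a marked ideal are pure weighted sequences** (translation of
BGMW Def. 3.1.3 / the `CentreSeq` vocabulary of `Resolution/BlowupSequences.lean` into `IsPureWeightedSeq`):
along an admissible sequence `s` for the marked ideal `M = (X, 𝓘, E, μ)`, the ideal `𝓘` is carried to the
ideal of the transform by a pure weight-`μ` sequence — each centre is regular, lies in `supp(𝓘_j, μ)` and
has simple normal crossings with the boundary, so `𝓘_j ≤ C_j^μ` (BGMW Lemma 3.2.1 (1),
`MarkedIdeal.ideal_le_pow`), and the transform is the weight-`μ` controlled transform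
(`MarkedIdeal.pow_mul_transform_ideal`). [cite: BierstoneGrigorievMilmanWlodarczyk2011, Def. 3.1.3, Lemma 3.2.1]
-/
theorem pureWeightedSeq_of_isAdmissibleFor :
    ∀ {X : Scheme.{u}} [IsLocallyNoetherian X] (s : CentreSeq X) (M : MarkedIdeal X),
      s.IsAdmissibleFor M → IsPureWeightedSeq M.mult s.comp M.ideal (s.transformMarked M).ideal
  | X, _, .nil _, M, _ => by
      exact IsPureWeightedSeq.nil M.ideal
  | X, _, .cons C rest, M, h => by
      obtain ⟨hsupp, hsnc, hreg, hrest⟩ := (CentreSeq.isAdmissibleFor_cons C rest M).mp h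
      haveI : IsLocallyNoetherian (blowup C) := CentreSeq.isLocallyNoetherian_blowup C
      have hπ : IsBlowup (blowup.π C) C := blowup.isBlowup C
      -- the first step
      have h1 : IsPureWeightedSeq M.mult (blowup.π C) M.ideal (M.transform (blowup.π C) C).ideal :=
        pureWeightedSeq_single (blowup.π C) M.ideal _ C hreg (M.ideal_le_pow hsupp hsnc) hπ
          (M.pow_mul_transform_ideal (blowup.π C) hsupp hsnc hπ).symm
      -- the rest, by induction, on the transform (same multiplicity)
      have h2 := pureWeightedSeq_of_isAdmissibleFor rest (M.transform (blowup.π C) C) hrest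
      rw [MarkedIdeal.transform_mult] at h2
      rw [CentreSeq.comp_cons, CentreSeq.transformMarked_cons]
      exact pureWeightedSeq_append h2 h1

/-- **Empty support of the end transform means order `< μ` everywhere** (`supp(𝓘', μ) = {x | μ ≤ ord_x 𝓘'}`,
BGMW Def. 3.1.2). [cite: BierstoneGrigorievMilmanWlodarczyk2011, Def. 3.1.2, Def. 3.1.3 (6)] -/
theorem idealOrder_lt_of_isResolutionOf {X : Scheme.{u}} (s : CentreSeq X) (M : MarkedIdeal X)
    (h : s.IsResolutionOf M) (x : s.top) :
    idealOrder (s.transformMarked M).ideal x < (M.mult : ℕ∞) := by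
  by_contra hx
  rw [not_lt] at hx
  have hmem : x ∈ (s.transformMarked M).support := by
    change ((s.transformMarked M).mult : ℕ∞) ≤ idealOrder (s.transformMarked M).ideal x
    rw [CentreSeq.transformMarked_mult]
    exact hx
  rw [h.2] at hmem
  exact hmem

/-! ### The monomial presentation of an snc-supported locally principal ideal -/

/-- **An snc-supported non-zero locally principal ideal sheaf is a marked-monomial ideal with simple normal
crossings boundary**: on a regular integral Noetherian scheme, `𝔟 = ∏_ζ 𝓘(cl{ζ})^{ord_ζ 𝔟}` over the
codimension-one points `ζ` of `V(𝔟)` (Cossart–Piltant 2008, proof of Prop. 4.2: the divisorial part; the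
cofactor is the unit ideal exactly when `𝔟` is locally principal — tree `DivisorialPart.lean`), and when
`Supp 𝔟` lies in a strict normal crossings divisor `B` these `ζ` are maximal points of `B`, whose component
ideals form a simple-normal-crossings list (Stacks 0BIA (2) ⇒ (1), `IsStrictNormalCrossingsDivisor.exists_hasSNC`).
[cite: CossartPiltant2008, proof of Prop. 4.2] [cite: StacksProject, Tag 0BIA]
[cite: Kollar2007, (3.111) Step 3] -/
theorem exists_monomial_presentation (E : Scheme.{u}) [IsIntegral E] [IsNoetherian E]
    (hE : Scheme.IsRegular E) {B : Set E} (hB : IsStrictNormalCrossingsDivisor E B)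
    (𝔟 : E.IdealSheafData) (h𝔟 : 𝔟 ≠ ⊥) (hlp : IsLocallyPrincipal 𝔟) (hsupp : (𝔟.support : Set E) ⊆ B) :
    ∃ L : List (E.IdealSheafData × ℕ), HasSNC (boundaryOf L) ∧ monomialIdeal L = 𝔟 := by
  classical
  obtain ⟨Es, hsnc, -, hmemEs, -⟩ := hB.exists_hasSNC hE
  have hfin : (divisorialPoints 𝔟).Finite := finite_divisorialPoints h𝔟
  -- `𝔟` is its own divisorial part
  have hJ : codimTwoPart 𝔟 = ⊤ := (isLocallyPrincipal_iff_codimTwoPart_eq_top hE h𝔟).mp hlp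
  have h𝔟eq : 𝔟 = ∏ ζ ∈ hfin.toFinset, primeDivisorIdeal ζ ^ (idealOrder 𝔟 ζ).toNat := by
    have h := divisorialPart_mul_codimTwoPart hE h𝔟
    rw [hJ, Scheme.IdealSheafData.mul_top, divisorialPart_eq hfin] at h
    exact h.symm
  -- the exponent list, indexed by the divisorial points
  refine ⟨hfin.toFinset.toList.map fun ζ => (primeDivisorIdeal ζ, (idealOrder 𝔟 ζ).toNat), ?_, ?_⟩
  · -- snc: every member is a component ideal of `B`
    refine hsnc.of_subset fun D hD => ?_
    simp only [List.map_map, List.mem_map, Finset.mem_toList, Set.Finite.mem_toFinset,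
      Function.comp_apply] at hD
    obtain ⟨ζ, hζ, rfl⟩ := hD
    rw [mem_divisorialPoints_iff] at hζ
    exact hmemEs ζ (DepthOne.mem_maxPoints_of_coheight_eq_one hB hζ.2 (hsupp hζ.1))
  · rw [monomialIdeal, List.map_map, Finset.prod_map_toList]
    exact h𝔟eq.symm

end DepthCleanup

namespace DepthTargets

/-- **TARGET (a) by name — the weight-`μ` cleanup of an snc-supported divisor holds for EVERY `μ`**
(plan-1's `WeightedCleanupSNC μ` of TargetsF2, 79dee2c27fd85ddd l.157): present `𝔟` as a marked monomial
ideal `(E, ∏ 𝓘(D_k)^{a_k}, (D_k), μ)` with simple-normal-crossings boundary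
(`DepthCleanup.exists_monomial_presentation`), resolve it by the tree's monomial order reduction
(`exists_isResolutionOf_monomialMarked`, Kollár (3.111) Step 3 / BGMW §4 Step 2b: blow up strata of maximal
weight `≥ μ`), and read the admissible `CentreSeq` as a pure weight-`μ` sequence
(`DepthCleanup.pureWeightedSeq_of_isAdmissibleFor`) whose end ideal has empty order-`μ` locus.
Fact-free; any dimension. [cite: Kollar2007, (3.111) Step 3]
[cite: BierstoneGrigorievMilmanWlodarczyk2011, §4 Step 2b, Def. 3.1.3, Lemma 3.2.1] -/
theorem weightedCleanupSNC_holds (μ : ℕ) : WeightedCleanupSNC.{u} μ := by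
  intro hμ E _ _ hE B hB 𝔟 h𝔟 hlp hsupp
  obtain ⟨L, hL, hL𝔟⟩ := DepthCleanup.exists_monomial_presentation E hE hB 𝔟 h𝔟 hlp hsupp
  obtain ⟨s, hs⟩ := exists_isResolutionOf_monomialMarked L hL hμ
  refine ⟨s.top, s.comp, (s.transformMarked (monomialMarked L μ)).ideal, ?_, fun x => ?_⟩
  · have h := DepthCleanup.pureWeightedSeq_of_isAdmissibleFor s (monomialMarked L μ) hs.1
    rwa [monomialMarked_ideal, hL𝔟] at h
  · exact DepthCleanup.idealOrder_lt_of_isResolutionOf s (monomialMarked L μ) hs x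

end DepthTargets

end Summit.ResolutionOfSingularities.ResolutionOfSingularities.Theorems

end
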